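import Literature.Probability.LatticeModels.GinibreInequality
import Mathlib.Analysis.SpecialFunctions.Complex.Circle
import HarnessLib

/-!
# Gaussian domination `Z(h) ≤ Z(0)` for generalised plane rotators (abelian lattice gauge theories)

Route-independent helper for item stmt-QuantumFields-23102 `Theses.TransverseWardBL.InfraredBound`
(LINE g9-C of the ideator seat ym-idea-4 on route `TransverseWardBL`; an abelian `U(1)` line onto the
leaf `Theorems.U1HelicityGapTorusD4` — nothing here bears on the Yang–Mills mass gap).

Setting = the tree's Ginibre model (`Literature.Probability.LatticeModels.GinibreModel`): a compact
second-countable abelian group `Ω` with Haar probability `μ`, finitely many continuous unitary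
characters `χₐ : Ω →ₜ* U(1)` and couplings `Jₐ ≥ 0` (for Wilson `U(1)` lattice gauge theory on a torus,
`Ω = U(1)^E`, `χ_p` = plaquette holonomy, `Jₐ = β`).  For arbitrary real PHASES `hₐ` put
`Z(h) = ∫ exp(∑ₐ Jₐ Re(χₐ(θ) e^{i hₐ})) dμ(θ) = ∫ exp(∑ₐ Jₐ cos(θₐ + hₐ)) dμ`.

* `integral_exp_shifted_le` — **Gaussian domination** `Z(h) ≤ Z(0)` for every `h`
  (`integral_expTrunc_shifted_le`: the same for the truncated exponential series).

Proof (positive-definiteness, no reflection positivity, no parity / evenness condition on the torus):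
the kernel `k(x, y) = expTrunc_N(∑ₐ Jₐ Re(xₐ ȳₐ))` on `U(1)^ι` is a positive kernel in Ginibre's sense
(`IsPosKernel`: `Re(x ȳ) = Re x Re y + Im x Im y`, closure under sums/products/`expTrunc`), hence obeys
the cross-term inequality `∫∫ k(a(u), b(v)) ≤ ½(∫∫ k(a,a) + ∫∫ k(b,b))` (`posKernel_integral_cross_le`,
termwise AM–GM after Fubini); with `a(u) = (χₐ(u) e^{ihₐ/2})ₐ`, `b(v) = (χₐ(v) e^{−ihₐ/2})ₐ` the three
kernels are `expTrunc_N` of the shifted / unshifted Hamiltonians at `u v⁻¹` (`reKernel_shift_apply`),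
and Haar invariance (`integral_prod_mul_inv_eq`) turns the double integrals into `Z_N(h) ≤ Z_N(0)`;
dominated convergence `N → ∞`.  References: Fröhlich–Simon–Spencer, Comm. Math. Phys. 50 (1976) 79
(Gaussian domination); J. Ginibre, Comm. Math. Phys. 16 (1970) 310 (positive kernels); A. Guth,
Phys. Rev. D 21 (1980) 2291 and J. Fröhlich–T. Spencer, Comm. Math. Phys. 83 (1982) 411 (the `U(1)₄`
infrared bound).  The second-order consequence (the infrared bound proper) is the companion file
`TransverseWardBLGinibreInfraredBound`.
-/

noncomputable section

open MeasureTheory Filter Finset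
open scoped Topology BigOperators
open Literature.Probability.LatticeModels

namespace Summit.QuantumFields.YangMills.Theorems.TransverseWardBL

/-! ### Positive kernels: the cross-term (Cauchy–Schwarz / AM–GM) inequality -/

/-- For a positive kernel `k = ∑ᵢ cᵢ Gᵢ ⊗ Gᵢ` and two continuous maps `a, b` into its space,
`∫∫ k(a(u), b(v)) ≤ ½ (∫∫ k(a(u), a(v)) + ∫∫ k(b(u), b(v)))` for every finite measure:
termwise `cᵢ AᵢBᵢ ≤ cᵢ (Aᵢ² + Bᵢ²)/2` with `Aᵢ = ∫ Gᵢ ∘ a`, `Bᵢ = ∫ Gᵢ ∘ b` (Fubini). [folklore] -/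
theorem posKernel_integral_cross_le {X : Type*} [TopologicalSpace X] {k : X × X → ℝ}
    (hk : IsPosKernel k) {Ω : Type*} [TopologicalSpace Ω] [CompactSpace Ω]
    [SecondCountableTopology Ω] [MeasurableSpace Ω] [BorelSpace Ω] (μ : Measure Ω)
    [IsFiniteMeasure μ] {a b : Ω → X} (ha : Continuous a) (hb : Continuous b) :
    ∫ p, k (a p.1, b p.2) ∂(μ.prod μ) ≤
      (∫ p, k (a p.1, a p.2) ∂(μ.prod μ) + ∫ p, k (b p.1, b p.2) ∂(μ.prod μ)) / 2 := by
  obtain ⟨κ, _, c, G, hc, hG, rfl⟩ := hk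
  have key : ∀ {a b : Ω → X}, Continuous a → Continuous b →
      ∫ p, (fun p : X × X => ∑ i, c i * (G i p.1 * G i p.2)) (a p.1, b p.2) ∂(μ.prod μ) =
        ∑ i, c i * ((∫ x, G i (a x) ∂μ) * ∫ y, G i (b y) ∂μ) := by
    intro a b ha hb
    have hint : ∀ i, Integrable (fun p : Ω × Ω => c i * (G i (a p.1) * G i (b p.2))) (μ.prod μ) :=
      fun i => integrable_of_continuous_compactSpace _
        (continuous_const.mul ((((hG i).comp ha).comp continuous_fst).mul
          (((hG i).comp hb).comp continuous_snd)))
    show ∫ p, ∑ i, c i * (G i (a p.1) * G i (b p.2)) ∂(μ.prod μ) = _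
    rw [integral_finsetSum _ fun i _ => hint i]
    refine Finset.sum_congr rfl fun i _ => ?_
    rw [integral_const_mul]
    congr 1
    exact integral_prod_mul (fun x => G i (a x)) (fun y => G i (b y))
  rw [key ha hb, key ha ha, key hb hb, ← Finset.sum_add_distrib, Finset.sum_div]
  refine Finset.sum_le_sum fun i _ => ?_
  have hci := hc i
  nlinarith [mul_nonneg hci (sq_nonneg ((∫ x, G i (a x) ∂μ) - ∫ y, G i (b y) ∂μ))]

/-! ### Haar bookkeeping on a compact abelian group -/

section Haar

variable {Ω : Type*} [CommGroup Ω] [TopologicalSpace Ω] [IsTopologicalGroup Ω] [CompactSpace Ω]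
  [SecondCountableTopology Ω] [MeasurableSpace Ω] [BorelSpace Ω]

/-- `∫∫ F(u v⁻¹) dμ(u) dμ(v) = ∫ F dμ` for a Haar probability measure `μ` (translation
invariance + Fubini). [folklore] -/
theorem integral_prod_mul_inv_eq (μ : Measure Ω) [μ.IsHaarMeasure] [IsProbabilityMeasure μ]
    {F : Ω → ℝ} (hF : Continuous F) :
    ∫ p, F (p.1 * p.2⁻¹) ∂(μ.prod μ) = ∫ θ, F θ ∂μ := by
  have hint : Integrable (fun p : Ω × Ω => F (p.1 * p.2⁻¹)) (μ.prod μ) :=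
    integrable_of_continuous_compactSpace _ (hF.comp (continuous_fst.mul continuous_snd.inv))
  rw [integral_prod_symm _ hint]
  have h : ∀ y : Ω, ∫ x, F (x * y⁻¹) ∂μ = ∫ x, F x ∂μ := fun y => by
    simp_rw [mul_comm _ y⁻¹]
    exact integral_mul_left_eq_self F y⁻¹
  simp_rw [h]
  simp

end Haar

/-! ### Pointwise identities for characters and phases -/

section Pointwise

variable {Ω : Type*} [CommGroup Ω] [TopologicalSpace Ω] {ι : Type*} [Fintype ι]

/-- `Re x Re y + Im x Im y = Re(x y⁻¹)` on the unit circle. [folklore] -/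
theorem circle_re_mul_re_add_im_mul_im (x y : Circle) :
    (x : ℂ).re * (y : ℂ).re + (x : ℂ).im * (y : ℂ).im = ((x * y⁻¹ : Circle) : ℂ).re := by
  rw [Circle.coe_mul, Circle.coe_inv_eq_conj, Complex.mul_re, Complex.conj_re, Complex.conj_im]
  ring

/-- `Re(z e^{is}) = Re z cos s − Im z sin s`. [folklore] -/
theorem circle_re_mul_exp (z : Circle) (s : ℝ) :
    ((z * Circle.exp s : Circle) : ℂ).re = (z : ℂ).re * Real.cos s - (z : ℂ).im * Real.sin s := by
  rw [Circle.coe_mul, Circle.coe_exp, Complex.mul_re, Complex.exp_ofReal_mul_I_re,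
    Complex.exp_ofReal_mul_I_im]

/-- The phase-shifted characters: `(χ(u) e^{is}) (χ(v) e^{ir})⁻¹ = χ(u v⁻¹) e^{i(s − r)}`. [folklore] -/
theorem char_mul_exp_mul_inv (χ : Ω →ₜ* Circle) (u v : Ω) (s r : ℝ) :
    (χ u * Circle.exp s) * (χ v * Circle.exp r)⁻¹ = χ (u * v⁻¹) * Circle.exp (s - r) := by
  rw [map_mul, map_inv, Circle.exp_sub, mul_inv, div_eq_mul_inv]
  exact mul_mul_mul_comm _ _ _ _

/-- The real-part kernel `∑ₐ Jₐ (Re xₐ Re yₐ + Im xₐ Im yₐ)` evaluated on phase-shifted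
characters: `∑ₐ Jₐ Re(χₐ(u v⁻¹) e^{i(sₐ − rₐ)})`. [folklore] -/
theorem reKernel_shift_apply (χ : ι → Ω →ₜ* Circle) (J s r : ι → ℝ) (u v : Ω) :
    (∑ a, J a * ((((χ a u * Circle.exp (s a) : Circle) : ℂ)).re *
        (((χ a v * Circle.exp (r a) : Circle) : ℂ)).re +
        (((χ a u * Circle.exp (s a) : Circle) : ℂ)).im *
        (((χ a v * Circle.exp (r a) : Circle) : ℂ)).im)) =
      ∑ a, J a * (reChar (χ a) (u * v⁻¹) * Real.cos (s a - r a) -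
        imChar (χ a) (u * v⁻¹) * Real.sin (s a - r a)) := by
  refine Finset.sum_congr rfl fun a _ => ?_
  rw [circle_re_mul_re_add_im_mul_im, char_mul_exp_mul_inv, circle_re_mul_exp]
  rfl

/-- `|R c − I s| ≤ 2` when all four numbers have absolute value `≤ 1`. [folklore] -/
theorem abs_mul_sub_mul_le_two {R I c s : ℝ} (hR : |R| ≤ 1) (hI : |I| ≤ 1) (hc : |c| ≤ 1)
    (hs : |s| ≤ 1) : |R * c - I * s| ≤ 2 := by
  have h1 : |R * c| ≤ 1 := by rw [abs_mul]; nlinarith [abs_nonneg R, abs_nonneg c]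
  have h2 : |I * s| ≤ 1 := by rw [abs_mul]; nlinarith [abs_nonneg I, abs_nonneg s]
  calc |R * c - I * s| ≤ |R * c| + |I * s| := abs_sub _ _
    _ ≤ 2 := by linarith

/-- Weighted triangle inequality `|∑ Jₐ gₐ| ≤ ∑ Jₐ Bₐ` for `Jₐ ≥ 0`, `|gₐ| ≤ Bₐ`. [folklore] -/
theorem abs_sum_mul_le {J g B : ι → ℝ} (hJ : ∀ a, 0 ≤ J a) (hg : ∀ a, |g a| ≤ B a) :
    |∑ a, J a * g a| ≤ ∑ a, J a * B a := by
  refine (Finset.abs_sum_le_sum_abs _ _).trans (Finset.sum_le_sum fun a _ => ?_)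
  rw [abs_mul, abs_of_nonneg (hJ a)]
  exact mul_le_mul_of_nonneg_left (hg a) (hJ a)

/-- The shifted Hamiltonian is bounded by `2 ∑ Jₐ`. [folklore] -/
theorem abs_shiftedHamiltonian_le (χ : ι → Ω →ₜ* Circle) {J : ι → ℝ} (hJ : ∀ a, 0 ≤ J a)
    (s : ι → ℝ) (θ : Ω) :
    |∑ a, J a * (reChar (χ a) θ * Real.cos (s a) - imChar (χ a) θ * Real.sin (s a))| ≤
      ∑ a, J a * 2 :=
  abs_sum_mul_le hJ fun _ => abs_mul_sub_mul_le_two (abs_reChar_le_one _ _)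
    (abs_imChar_le_one _ _) (Real.abs_cos_le_one _) (Real.abs_sin_le_one _)

/-- `expTrunc N` is continuous (a polynomial). [folklore] -/
theorem continuous_expTrunc (N : ℕ) : Continuous (expTrunc N) := by
  unfold expTrunc
  exact continuous_finsetSum _ fun n _ => (continuous_pow n).div_const _

/-- The shifted Hamiltonian is continuous. [folklore] -/
theorem continuous_shiftedHamiltonian (χ : ι → Ω →ₜ* Circle) (J s : ι → ℝ) :
    Continuous fun θ : Ω =>
      ∑ a, J a * (reChar (χ a) θ * Real.cos (s a) - imChar (χ a) θ * Real.sin (s a)) :=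
  continuous_finsetSum _ fun _ _ => continuous_const.mul
    (((continuous_reChar _).mul continuous_const).sub ((continuous_imChar _).mul continuous_const))

end Pointwise

/-! ### Gaussian domination `Z(h) ≤ Z(0)` -/

section Domination

variable {Ω : Type*} [CommGroup Ω] [TopologicalSpace Ω] [IsTopologicalGroup Ω] [CompactSpace Ω]
  [SecondCountableTopology Ω] [MeasurableSpace Ω] [BorelSpace Ω] {ι : Type*} [Fintype ι]

/-- **Gaussian domination for generalised plane rotators / abelian lattice gauge theories
(truncated weights).** For every `N`, couplings `Jₐ ≥ 0` and phases `hₐ`,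
`∫ expTrunc_N(∑ Jₐ Re(χₐ e^{ihₐ})) dμ ≤ ∫ expTrunc_N(∑ Jₐ Re χₐ) dμ`. [folklore] -/
theorem integral_expTrunc_shifted_le (μ : Measure Ω) [μ.IsHaarMeasure] [IsProbabilityMeasure μ]
    (χ : ι → Ω →ₜ* Circle) {J : ι → ℝ} (hJ : ∀ a, 0 ≤ J a) (h : ι → ℝ) (N : ℕ) :
    ∫ θ, expTrunc N (∑ a, J a * (reChar (χ a) θ * Real.cos (h a) - imChar (χ a) θ * Real.sin (h a))) ∂μ ≤
      ∫ θ, expTrunc N (∑ a, J a * (reChar (χ a) θ * Real.cos 0 - imChar (χ a) θ * Real.sin 0)) ∂μ := by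
  -- the real-part kernel on `ι → Circle` and the two phase-shifted character maps
  set k₀ : (ι → Circle) × (ι → Circle) → ℝ := fun p =>
    ∑ a, J a * (((p.1 a : ℂ)).re * ((p.2 a : ℂ)).re + ((p.1 a : ℂ)).im * ((p.2 a : ℂ)).im) with hk₀
  have hk₀pos : IsPosKernel k₀ := by
    have hre : ∀ a : ι, Continuous fun x : ι → Circle => ((x a : ℂ)).re := fun a =>
      Complex.continuous_re.comp (continuous_subtype_val.comp (continuous_apply a))
    have him : ∀ a : ι, Continuous fun x : ι → Circle => ((x a : ℂ)).im := fun a =>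
      Complex.continuous_im.comp (continuous_subtype_val.comp (continuous_apply a))
    have : k₀ = ∑ a : ι, fun p => J a *
        ((fun p : (ι → Circle) × (ι → Circle) => ((p.1 a : ℂ)).re * ((p.2 a : ℂ)).re) +
          (fun p : (ι → Circle) × (ι → Circle) => ((p.1 a : ℂ)).im * ((p.2 a : ℂ)).im)) p := by
      funext p; simp [hk₀, Finset.sum_apply]
    rw [this]
    exact IsPosKernel.sum fun a _ =>
      ((isPosKernel_mul_self (hre a)).add (isPosKernel_mul_self (him a))).const_mul (hJ a)
  have hkN : IsPosKernel (fun p => expTrunc N (k₀ p)) := hk₀pos.comp_expTrunc N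
  set amap : Ω → ι → Circle := fun θ a => χ a θ * Circle.exp (h a / 2) with hamap
  set bmap : Ω → ι → Circle := fun θ a => χ a θ * Circle.exp (-(h a / 2)) with hbmap
  have hac : Continuous amap := continuous_pi fun a => (χ a).continuous.mul continuous_const
  have hbc : Continuous bmap := continuous_pi fun a => (χ a).continuous.mul continuous_const
  have hcross := posKernel_integral_cross_le hkN μ hac hbc
  -- identify the three kernels as functions of `u v⁻¹`
  have hab : ∀ u v : Ω, expTrunc N (k₀ (amap u, bmap v)) = expTrunc N
      (∑ a, J a * (reChar (χ a) (u * v⁻¹) * Real.cos (h a) - imChar (χ a) (u * v⁻¹) * Real.sin (h a))) := by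
    intro u v
    simp only [hk₀, hamap, hbmap]
    rw [reKernel_shift_apply]
    simp only [sub_neg_eq_add, add_halves]
  have haa : ∀ u v : Ω, expTrunc N (k₀ (amap u, amap v)) = expTrunc N
      (∑ a, J a * (reChar (χ a) (u * v⁻¹) * Real.cos 0 - imChar (χ a) (u * v⁻¹) * Real.sin 0)) := by
    intro u v
    simp only [hk₀, hamap]
    rw [reKernel_shift_apply]
    simp only [sub_self]
  have hbb : ∀ u v : Ω, expTrunc N (k₀ (bmap u, bmap v)) = expTrunc N
      (∑ a, J a * (reChar (χ a) (u * v⁻¹) * Real.cos 0 - imChar (χ a) (u * v⁻¹) * Real.sin 0)) := by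
    intro u v
    simp only [hk₀, hbmap]
    rw [reKernel_shift_apply]
    simp only [sub_self]
  simp only [hab, haa, hbb] at hcross
  have e1 : ∫ p : Ω × Ω, expTrunc N (∑ a, J a * (reChar (χ a) (p.1 * p.2⁻¹) * Real.cos (h a) -
      imChar (χ a) (p.1 * p.2⁻¹) * Real.sin (h a))) ∂(μ.prod μ) = ∫ θ, expTrunc N
      (∑ a, J a * (reChar (χ a) θ * Real.cos (h a) - imChar (χ a) θ * Real.sin (h a))) ∂μ :=
    integral_prod_mul_inv_eq μ
      ((continuous_expTrunc N).comp (continuous_shiftedHamiltonian χ J h))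
  have e2 : ∫ p : Ω × Ω, expTrunc N (∑ a, J a * (reChar (χ a) (p.1 * p.2⁻¹) * Real.cos 0 -
      imChar (χ a) (p.1 * p.2⁻¹) * Real.sin 0)) ∂(μ.prod μ) = ∫ θ, expTrunc N
      (∑ a, J a * (reChar (χ a) θ * Real.cos 0 - imChar (χ a) θ * Real.sin 0)) ∂μ :=
    integral_prod_mul_inv_eq μ
      ((continuous_expTrunc N).comp (continuous_shiftedHamiltonian χ J (fun _ => 0)))
  rw [e1, e2] at hcross
  linarith

/-- **Gaussian domination** `Z(h) ≤ Z(0)`: for couplings `Jₐ ≥ 0` and arbitrary phases `hₐ`,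
`∫ exp(∑ₐ Jₐ Re(χₐ(θ) e^{ihₐ})) dμ(θ) ≤ ∫ exp(∑ₐ Jₐ Re χₐ(θ)) dμ(θ)` on a compact abelian group
with Haar probability `μ` (positive-definiteness of the weight as a function of the character
values; no reflection positivity, no parity condition). [folklore] -/
theorem integral_exp_shifted_le (μ : Measure Ω) [μ.IsHaarMeasure] [IsProbabilityMeasure μ]
    (χ : ι → Ω →ₜ* Circle) {J : ι → ℝ} (hJ : ∀ a, 0 ≤ J a) (h : ι → ℝ) :
    ∫ θ, Real.exp (∑ a, J a * (reChar (χ a) θ * Real.cos (h a) - imChar (χ a) θ * Real.sin (h a))) ∂μ ≤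
      ∫ θ, ginibreWeight χ J θ ∂μ := by
  have hlim : ∀ s : ι → ℝ, Tendsto (fun N => ∫ θ, expTrunc N
      (∑ a, J a * (reChar (χ a) θ * Real.cos (s a) - imChar (χ a) θ * Real.sin (s a))) ∂μ) atTop
      (𝓝 (∫ θ, Real.exp
        (∑ a, J a * (reChar (χ a) θ * Real.cos (s a) - imChar (χ a) θ * Real.sin (s a))) ∂μ)) := by
    intro s
    refine tendsto_integral_of_dominated_convergence (fun _ => Real.exp (∑ a, J a * 2)) ?_
      (integrable_const _) ?_ ?_
    · exact fun N => ((continuous_expTrunc N).comp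
        (continuous_shiftedHamiltonian χ J s)).aestronglyMeasurable
    · exact fun N => ae_of_all _ fun θ => by
        rw [Real.norm_eq_abs]
        exact abs_expTrunc_le (abs_shiftedHamiltonian_le χ hJ s θ) N
    · exact ae_of_all _ fun θ => tendsto_expTrunc _
  have h0 : (fun θ => Real.exp
      (∑ a, J a * (reChar (χ a) θ * Real.cos ((fun _ => (0 : ℝ)) a) -
        imChar (χ a) θ * Real.sin ((fun _ => (0 : ℝ)) a)))) = ginibreWeight χ J := by
    funext θ
    simp [ginibreWeight, ginibreHamiltonian]
  rw [← h0]
  exact le_of_tendsto_of_tendsto (hlim h) (hlim fun _ => 0)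
    (Filter.Eventually.of_forall fun N => integral_expTrunc_shifted_le μ χ hJ h N)

end Domination

end Summit.QuantumFields.YangMills.Theorems.TransverseWardBL

end
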